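/- Width seat `ym-line-cbag-p1-w2` (prover-ym-line-cbag-p1-w2-g15-0; own items stmt-QuantumFields-22254 / 22893 CLOSED) on the
planner-of-record's LINE 4, route `U1DipoleHelicity`, crux `WilsonU1DipoleLawD4` (stmt-QuantumFields-25880): the GAUSSIAN (spin-wave,
infinite-volume) calibration — the functional form of stub 1 `stub_villainDipoleCalibration` (same `β'` for all `z`, error
`(C/βV)·(1+|z|₁)⁻⁵` with `C·Σw ≤ ε`) IS satisfied by the spin-wave value `e^{−K(0)/βV} sinh(K(z)/βV)` with `β' = βV e^{K(0)/βV}`.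
Helper `--supports stmt-QuantumFields-25880`; no stub is closed here.  Nothing in this file bears on the Yang–Mills mass gap. -/
import Summits.QuantumFields.YangMills.Theorems.U1DipoleHelicityFreeKDecay
import HarnessLib

/-!
# Crux `WilsonU1DipoleLawD4` (stmt-QuantumFields-25880): the spin-wave calibration in the shape of stub 1

By `villainPlaqCorr_eq_spinWave_gas` the Villain two-plaquette function is `½e^{−(E_p+E_q)/2βV}(e^{B/βV}A⁻ − e^{−B/βV}A⁺)`; its pure
spin-wave part (`A^∓ = 1`) is `e^{−(E_p+E_q)/2βV} sinh(B/βV)`, and — granting the free-boundary kernel limits `E_p, E_q → K(0)`,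
`B → K(z)` (`K = freeK = curvatureTwoPoint`, NOT proved in the tree) — its infinite-volume value is
`SW_βV(z) = e^{−K(0)/βV} sinh(K(z)/βV)`.  This file proves that `SW` satisfies the registered stub's functional form EXACTLY, with the
explicit renormalised coupling `β' = βV·e^{K(0)/βV} = βV·e^{1/(2βV)}`:

* `inv_pow_five_le_weight`: `(1+‖z‖_∞)⁻⁵ ≤ 4⁵·weight z` (`|z|₁ ≤ 4‖z‖_∞`);
* `abs_spinWave_sub_le`: for `βV ≥ β₀` and all `z`, `|SW_βV(z) − K(z)/β'| ≤ (C/βV²)·weight z`;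
* **`spinWave_dipoleCalibration`**: `∀ ε > 0, ∃ β₁ ≥ 1, ∀ βV > β₁, ∃ β' > 0, ∃ C ≥ 0, C·Σ_z w(z) ≤ ε ∧ ∀ z, |SW_βV(z) − K(z)/β'| ≤ (C/βV)·w(z)`
  — verbatim the quantifier shape of `stub_villainDipoleCalibration` with `villainPlaqCorr βV n z` replaced by its (n-independent)
  infinite-volume spin-wave value (so the `∀ᶠ n` is vacuous here).

Reading: the Gaussian dipole law costs nothing beyond the dipole decay `|K(z)| ≤ C'(1+‖z‖_∞)⁻⁴` (`exists_abs_freeK_le`); everything that is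
hard in stub 1 is (i) the free-boundary spin-wave kernel limit and (ii) the monopole-gas content (sizing note on the item).  RECORD-type
material on an abelian comparison line; the Yang–Mills mass gap is NOT proved by anything here.
-/

set_option autoImplicit false

noncomputable section

namespace Summit.QuantumFields.YangMills.Theorems.U1DipoleHelicity

open Finset
open scoped Real
open Literature.Probability.LatticeModels

/-! ### Elementary estimates -/

/-- `(1+‖z‖_∞)⁻⁵ ≤ 4⁵ · weight z` (`|z|₁ ≤ 4‖z‖_∞`, so `1+|z|₁ ≤ 4(1+‖z‖_∞)`). [folklore] -/
theorem inv_pow_five_le_weight (z : Literature.Probability.LatticeModels.Site 4) :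
    ((1 + (Site.supNorm z : ℝ)) ^ 5)⁻¹ ≤ 4 ^ 5 * weight z := by
  have hsum : ∑ i : Fin 4, |(z i : ℝ)| ≤ 4 * (Site.supNorm z : ℝ) := by
    have h : ∀ i : Fin 4, |(z i : ℝ)| ≤ (Site.supNorm z : ℝ) := fun i => by
      rw [← Int.cast_abs, Int.abs_eq_natAbs]
      exact_mod_cast Site.natAbs_le_supNorm z i
    calc ∑ i : Fin 4, |(z i : ℝ)| ≤ ∑ _i : Fin 4, (Site.supNorm z : ℝ) := Finset.sum_le_sum fun i _ => h i
      _ = 4 * (Site.supNorm z : ℝ) := by simp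
  have hm : (0 : ℝ) ≤ (Site.supNorm z : ℝ) := Nat.cast_nonneg _
  have hs0 : 0 ≤ ∑ i : Fin 4, |(z i : ℝ)| := Finset.sum_nonneg fun i _ => abs_nonneg _
  have key : (4 : ℝ) ^ 5 * weight z = (((1 + ∑ i : Fin 4, |(z i : ℝ)|) / 4) ^ 5)⁻¹ := by
    unfold weight
    rw [div_pow, inv_div, div_eq_mul_inv]
  rw [key]
  refine inv_anti₀ (by positivity) (pow_le_pow_left₀ (by positivity) ?_ 5)
  linarith

/-! ### The spin-wave value against `K(z)/β'` -/

/-- **Pointwise spin-wave budget.**  There are `β₀ ≥ 1` and `C ≥ 0` such that for every `βV ≥ β₀` and every `z ∈ ℤ⁴`,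
`|e^{−K(0)/βV} sinh(K(z)/βV) − K(z)/(βV e^{K(0)/βV})| ≤ (C/βV²)·weight z` (`K = freeK`; `|sinh x − x| ≤ x²`, `|K(z)| ≤ C'(1+‖z‖_∞)⁻⁴`,
`(1+‖z‖_∞)⁻⁸ ≤ (1+‖z‖_∞)⁻⁵ ≤ 4⁵ w(z)`). [folklore] -/
theorem abs_spinWave_sub_le :
    ∃ β₀ C : ℝ, 1 ≤ β₀ ∧ 0 ≤ C ∧ ∀ βV : ℝ, β₀ ≤ βV → ∀ z : Literature.Probability.LatticeModels.Site 4,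
      |Real.exp (-(freeK 0 / βV)) * Real.sinh (freeK z / βV) - freeK z / (βV * Real.exp (freeK 0 / βV))| ≤
        C / βV ^ 2 * weight z := by
  obtain ⟨C', hC', hK⟩ := exists_abs_freeK_le
  refine ⟨max 1 C', 4 ^ 5 * C' ^ 2, le_max_left _ _, by positivity, fun βV hβ z => ?_⟩
  have hβ1 : 1 ≤ βV := le_trans (le_max_left _ _) hβ
  have hβC : C' ≤ βV := le_trans (le_max_right _ _) hβ
  have hβ0 : 0 < βV := by linarith
  have hm0 : (0 : ℝ) ≤ (Site.supNorm z : ℝ) := Nat.cast_nonneg _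
  have hKz := hK z
  -- `|K z| ≤ C'`
  have hKC : |freeK z| ≤ C' := by
    refine hKz.trans (div_le_self hC' ?_)
    exact one_le_pow₀ (by linarith)
  -- the argument of `sinh` is at most `1`
  have hx1 : |freeK z / βV| ≤ 1 := by
    rw [abs_div, abs_of_pos hβ0, div_le_one hβ0]
    exact hKC.trans hβC
  -- `|sinh x − x| ≤ x²` for `|x| ≤ 1` (the tree has this as `Literature.NumberTheory.LFunctions.abs_sinh_sub_le`; re-derived inline from
  -- Mathlib's `|e^x − 1 − x| ≤ x²` to keep the import closure inside the lattice-gauge corner)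
  have hsinh : ∀ {x : ℝ}, |x| ≤ 1 → |Real.sinh x - x| ≤ x ^ 2 := by
    intro x hx
    have h1 := Real.abs_exp_sub_one_sub_id_le hx
    have h2 := Real.abs_exp_sub_one_sub_id_le (show |-x| ≤ 1 by rwa [abs_neg])
    rw [Real.sinh_eq]
    have e1 : (Real.exp x - Real.exp (-x)) / 2 - x = ((Real.exp x - 1 - x) - (Real.exp (-x) - 1 - -x)) / 2 := by ring
    rw [e1, abs_div, abs_two]
    have h3 := abs_sub (Real.exp x - 1 - x) (Real.exp (-x) - 1 - -x)
    rw [neg_sq] at h2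
    linarith
  have hE1 : Real.exp (-(freeK 0 / βV)) ≤ 1 := by
    rw [Real.exp_le_one_iff, neg_nonpos, freeK_zero]; positivity
  -- rewrite the target as `e^{-K0/β} (sinh x - x)`
  have key : Real.exp (-(freeK 0 / βV)) * Real.sinh (freeK z / βV) - freeK z / (βV * Real.exp (freeK 0 / βV)) =
      Real.exp (-(freeK 0 / βV)) * (Real.sinh (freeK z / βV) - freeK z / βV) := by
    rw [Real.exp_neg, mul_sub]
    field_simp
  rw [key, abs_mul, abs_of_pos (Real.exp_pos _)]
  have hsq : freeK z ^ 2 ≤ (C' / (1 + (Site.supNorm z : ℝ)) ^ 4) ^ 2 := by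
    have := pow_le_pow_left₀ (abs_nonneg _) hKz 2
    rwa [sq_abs] at this
  have h85 : ((1 + (Site.supNorm z : ℝ)) ^ 8)⁻¹ ≤ ((1 + (Site.supNorm z : ℝ)) ^ 5)⁻¹ :=
    inv_anti₀ (by positivity) (pow_le_pow_right₀ (by linarith) (by norm_num))
  calc Real.exp (-(freeK 0 / βV)) * |Real.sinh (freeK z / βV) - freeK z / βV| ≤ 1 * (freeK z / βV) ^ 2 :=
        mul_le_mul hE1 (hsinh hx1) (abs_nonneg _) zero_le_one
    _ = freeK z ^ 2 / βV ^ 2 := by rw [one_mul, div_pow]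
    _ ≤ (C' / (1 + (Site.supNorm z : ℝ)) ^ 4) ^ 2 / βV ^ 2 := div_le_div_of_nonneg_right hsq (by positivity)
    _ = C' ^ 2 / βV ^ 2 * ((1 + (Site.supNorm z : ℝ)) ^ 8)⁻¹ := by
        have h1 : (1 + (Site.supNorm z : ℝ)) ≠ 0 := by positivity
        field_simp
    _ ≤ C' ^ 2 / βV ^ 2 * ((1 + (Site.supNorm z : ℝ)) ^ 5)⁻¹ := mul_le_mul_of_nonneg_left h85 (by positivity)
    _ ≤ C' ^ 2 / βV ^ 2 * (4 ^ 5 * weight z) :=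
        mul_le_mul_of_nonneg_left (inv_pow_five_le_weight z) (by positivity)
    _ = 4 ^ 5 * C' ^ 2 / βV ^ 2 * weight z := by ring

/-- **The spin-wave (Gaussian, infinite-volume) calibration in the exact shape of stub 1 of crux 25880.**  For every `ε > 0` there is
`β₁ ≥ 1` such that for every `βV > β₁` there are `β' > 0` (namely `β' = βV e^{K(0)/βV}`, `K(0) = 1/2`) and `C ≥ 0` with `C·Σ_z w(z) ≤ ε`
and `|e^{−K(0)/βV} sinh(K(z)/βV) − K(z)/β'| ≤ (C/βV)·w(z)` for all `z ∈ ℤ⁴`, `K = freeK`, `w = weight`.  This is the statement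
`stub_villainDipoleCalibration` with `villainPlaqCorr βV n z` replaced by the spin-wave value it would take in infinite volume if the
monopole (flux-gas) averages were `1`; what separates it from the stub is the free-boundary kernel limit and the flux-gas content.
[cite: FrohlichSpencerCMP1982, §2.11 (2.89)–(2.90)] -/
theorem spinWave_dipoleCalibration :
    ∀ ε : ℝ, 0 < ε → ∃ β₁ : ℝ, 1 ≤ β₁ ∧ ∀ βV : ℝ, β₁ < βV → ∃ β' : ℝ, 0 < β' ∧ ∃ C : ℝ, 0 ≤ C ∧
      C * (∑' z, weight z) ≤ ε ∧ ∀ z : Literature.Probability.LatticeModels.Site 4,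
        |Real.exp (-(freeK 0 / βV)) * Real.sinh (freeK z / βV) - freeK z / β'| ≤ C / βV * weight z := by
  intro ε hε
  obtain ⟨β₀, C, hβ₀, hC, H⟩ := abs_spinWave_sub_le
  set S : ℝ := ∑' z, weight z with hS
  have hS0 : 0 ≤ S := tsum_nonneg fun z => (weight_pos z).le
  -- choose `β₁` so large that `C S / β₁ ≤ ε`
  refine ⟨max β₀ (C * S / ε), le_trans hβ₀ (le_max_left _ _), fun βV hβ => ?_⟩
  have hβ0' : β₀ ≤ βV := le_of_lt (lt_of_le_of_lt (le_max_left _ _) hβ)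
  have hβpos : 0 < βV := by linarith
  have hβε : C * S / ε < βV := lt_of_le_of_lt (le_max_right _ _) hβ
  refine ⟨βV * Real.exp (freeK 0 / βV), by positivity, C / βV, by positivity, ?_, fun z => ?_⟩
  · -- `C/βV · S ≤ ε`
    rw [div_mul_eq_mul_div, div_le_iff₀ hβpos]
    have := (div_lt_iff₀ hε).1 hβε
    linarith
  · have h := H βV hβ0' z
    rw [show C / βV / βV = C / βV ^ 2 by rw [div_div, sq]]
    exact h

end Summit.QuantumFields.YangMills.Theorems.U1DipoleHelicity

end
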